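/-
Copyright (c) 2026 the pub-hodgecm-mathlib formalisation cell (harness21).  Prover seat hodgecm-mathlib-K2Liu-p09 (g3): Track B «K2-LIT», #184♮ = hLiu418,
payer-internal organ O4-inert «Λ-BOUNDS AT INERT PLACES» of file #34 `Theorems/K2LiuDoublingZetaGL1.lean` (LEAD F0P6-plan (g10) DEAL K2/STATUS 2026-09-04T02:36:29Z;
REPORT-FIRST #34 v3, K2/K2Liu-p09/g3; DEPMAP v2.7 §13 `hInert` FEED TABLE row «`Λ_v ≡ 1` on `K_v`, `Integrable`, `∫‖Λ_v‖ ≤ B` — p09's O4 … inert twin»).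
-/
import Summits.HodgeConjecture.HodgeConjecture.Theorems.K2LiuUnramifiedDoublingHeckeIdentityInert   -- ★ #28i and its whole ★ import cone (row 26 inert, #27i, H3a, Prelims)
import HarnessLib

/-!
# Crux `HLiu418`, Track B road `K2_Liu`, file #34 — organ O4 (inert half) «THE UNRAMIFIED LOCAL SECTION `Λ_{s,v} ∘ ι_v(·,1)` IS `L¹` ON `U(V)(L⁺_v)`
# WITH `∫ |Λ| ≤ 1 + C·q_v^{−2 Re s}` AT EVERY INERT UNRAMIFIED GOOD PLACE»

Cell `hodgecm-mathlib`, crux item hLiu418 = `stmt-HodgeConjecture-24832`, route of record `HCCMUnconditional`; squad K2 ∕ K2Liu, prover K2Liu-p09 (g3).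
THEOREMS ONLY (no `def`, no instance, no notation, no named-fact hypothesis, no `sorry`); lane `--supports stmt-HodgeConjecture-24832 --as helper`.

The inert twin of ★ O4 `K2LiuDoublingZetaGL1LambdaSplit.exists_integral_norm_lambdaLoc_le` (p857152), in ★ #28i's frame
(`K2LiuUnramifiedDoublingHeckeIdentityInert`, p857283) and with ITS arithmetic: the Cartan family `m ↦ t₁ᵐ` (★ `isCartanFamily_localInt_inert`,
★ `coe_pow_of_coe_eq_conj_diagonal`), the values `Λ_{s,v}(ι_v(t₁ᵐ,1)) = (χ(ϖ_w) q_v^{−(2s+2)})ᵐ` (★ #27i `lambdaLoc_iotaLeftLocPi_cartan_inert`, `N(w) = q_v²`,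
`‖ϖ‖_w = q_v^{−2}`), the shell sizes `#(K_v t₁ᵐ K_v ∕ K_v) = 1, (q_v+1) q_v (q_v²)^{m−1}` (★ H3a `ncard_orbit_pow_inert`, ★ `measure_doubleCoset_eq_ncard_mul`):
* `exists_integral_norm_lambdaLoc_le_inert`: for every `σ₀ > 0` there is ONE constant `C = C(σ₀) = 2 ∕ (1 − 2^{−2σ₀}) ≥ 0` such that at every inert
  unramified good `v` (binders = ★ #28i's frame prefix verbatim), every `s` with `σ₀ ≤ Re s` and every Haar `ν` with `ν(K_v) = 1`:
  `Λ_{s,v} ∘ ι_v(·,1) ∈ L¹(ν)` and `∫ ‖Λ_{s,v}(ι_v(g,1))‖ dν(g) ≤ 1 + C · q_v^{−2 Re s}`.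
  Proof: `∫ ‖Λ‖ = Σ_m ν(K t₁ᵐ K) q^{−(2σ+2)m}`; the `m = 0` term is `ν(K) = 1`; for `m = k+1` the term is `(q+1) q (q²)ᵏ q^{−(2σ+2)(k+1)} =
  (1 + q⁻¹)(q^{−2σ})^{k+1} ≤ 2 q^{−2σ} (2^{−2σ₀})ᵏ`, and `Σ_k (2^{−2σ₀})ᵏ = (1 − 2^{−2σ₀})⁻¹`.
With ★ O4b `K2LiuDoublingZetaGL1LambdaProd.exists_bound_finsetProd` (p857488; exponent `2 Re s ≥ Re s > 1`) this is ★ #29s's `_hΛint ∕ _hΛbd` at the inert places.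

HONEST LABEL: HC_CM is proved only modulo the printed citations (2 remaining named inputs: hLiu418 = stmt-HodgeConjecture-24832,
h413 = stmt-HodgeConjecture-24833) until rung 0 closes; this file is bookkeeping toward socket s23 and closes no item.
References: [Li1992] §3 Thm. 3.1; [GelbartPiatetskishapiroRallis1987] Part A §6; [Macdonald1971] Ch. V §3 (3.9); [BruhatTits1972] (4.4.3)–(4.4.4);
[CasselsFrohlichANT1967] Ch. XV §3.3.
-/

set_option autoImplicit false
set_option linter.dupNamespace false

noncomputable section

open scoped Matrix Pointwise Valued
open NumberField IsDedekindDomain Matrix MeasureTheory MulAction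

namespace Summit.HodgeConjecture.HodgeConjecture.Cruxes.HLiu418.K2LiuDoublingZetaGL1LambdaInert

open Literature.NumberTheory.Automorphic Literature.NumberTheory.Automorphic.UnitaryGroup Literature.NumberTheory.GaloisRepresentations
open Literature.NumberTheory.GelbartRogawski1991 Literature.NumberTheory.GelbartRogawski1991.GRConstruction
open Literature.NumberTheory.GelbartRogawski1991.UnitaryDualPair
open Literature.NumberTheory.K2Lit Literature.NumberTheory.K2Lit.SiegelDoubled
open Summit.HodgeConjecture.HodgeConjecture.Cruxes.HLiu418.K2LiuCartanFamilyInert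
open Summit.HodgeConjecture.HodgeConjecture.Cruxes.HLiu418.K2LiuUnramifiedSectionOnCartan
open Summit.HodgeConjecture.HodgeConjecture.Cruxes.HLiu418.K2LiuUnramifiedSectionOnCartanInert
open Summit.HodgeConjecture.HodgeConjecture.Cruxes.HLiu418.K2LiuDoublingHeckeCartanSum
open Summit.HodgeConjecture.HodgeConjecture.Cruxes.HLiu418.K2LiuUnramifiedDoublingHeckePrelims
open Summit.HodgeConjecture.HodgeConjecture.Cruxes.HLiu418.K2LiuInertHeckeRecursion

/-- the elementary bound behind O4-inert: for `1 ≤ q`, `0 ≤ r`, `q·q·r = x`: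
`(q+1)·q·(q·q)ᵏ·r^{k+1} ≤ 2·x^{k+1}` (`(q+1) q r ≤ 2 q q r`). [cite: Li1992, §3 Thm. 3.1] -/
theorem shell_term_le {q r x : ℝ} (hq : 1 ≤ q) (hr : 0 ≤ r) (hx : q * q * r = x) (k : ℕ) :
    (q + 1) * q * (q * q) ^ k * r ^ (k + 1) ≤ 2 * x ^ (k + 1) := by
  have hx0 : 0 ≤ x := by rw [← hx]; positivity
  have h1 : (q + 1) * q * (q * q) ^ k * r ^ (k + 1) = ((q + 1) * q * r) * x ^ k := by
    rw [← hx, pow_succ, mul_pow]; ring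
  have h2 : (q + 1) * q * r ≤ 2 * x := by
    rw [← hx]
    have : (q + 1) * q * r ≤ (2 * q) * q * r := by gcongr; linarith
    linarith
  rw [h1, pow_succ]
  calc (q + 1) * q * r * x ^ k ≤ 2 * x * x ^ k := mul_le_mul_of_nonneg_right h2 (pow_nonneg hx0 k)
    _ = 2 * (x ^ k * x) := by ring

set_option maxHeartbeats 1600000 in -- the adelic unitary datum: `localPi`, `localInt`, `LambdaLoc`, Cartan family (as ★ #28i)
/-- **ORGAN O4 OF #34 (INERT HALF) — `Λ_{s,v} ∘ ι_v(·,1)` IS `L¹` WITH `∫ |Λ| ≤ 1 + C(σ₀)·q_v^{−2 Re s}` AT AN INERT UNRAMIFIED GOOD PLACE.**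
For every `σ₀ > 0` there is `C ≥ 0` such that, in ★ #28i's frame (`e : Fin 2 × Fin 1 ≃ Fin n`, `dV dW ≠ 0`, an inert unramified place `w ∣ v` of good reduction,
`χ` unitary and unramified above `v`, Haar `ν` on `U(V)(L⁺_v)` with `ν(K_v) = 1`, the inert frame `ϖ, T, t₁`), for every `s` with `σ₀ ≤ Re s`:
`g ↦ Λ_{s,v}(ι_v(g,1))` is `ν`-integrable and `∫ ‖Λ_{s,v}(ι_v(g,1))‖ dν ≤ 1 + C · q_v^{−2 Re s}`.
[cite: Li1992, §3 Thm. 3.1] [cite: GelbartPiatetskishapiroRallis1987, Part A §6] [cite: Macdonald1971, Ch. V §3 (3.9)] [cite: BruhatTits1972, (4.4.4)] -/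
theorem exists_integral_norm_lambdaLoc_le_inert (σ₀ : ℝ) (hσ₀ : 0 < σ₀) :
    ∃ C : ℝ, 0 ≤ C ∧
    ∀ (L : Type) [Field L] [NumberField L] [IsCMField L] {n : ℕ} (e : Fin 2 × Fin 1 ≃ Fin n)
      (dV : Fin 2 → L) (hdV : ∀ i, IsCMField.complexConj L (dV i) = dV i) (_hdV0 : ∀ i, dV i ≠ 0)
      (dW : Fin 1 → L) (hdW : ∀ i, IsCMField.complexConj L (dW i) = dW i) (_hdW0 : ∀ i, dW i ≠ 0)
      (v : HeightOneSpectrum (𝓞 (Fp L)))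
      (w : UnitaryGroup.PlacesOver L v) (_hw : IsCMField.complexConj L • w.1 = w.1) (_hv : Algebra.IsUnramifiedIn (𝓞 L) v.asIdeal)
      (_h2 : ∀ w' : UnitaryGroup.PlacesOver L v, ValuativeRel.valuation (w'.1.adicCompletion L) (2 : w'.1.adicCompletion L) = 1)
      (_hdVw : ∀ (w' : UnitaryGroup.PlacesOver L v) (i : Fin 2),
        ValuativeRel.valuation (w'.1.adicCompletion L) (algebraMap L (w'.1.adicCompletion L) (dV i)) = 1)
      (_hT : ∀ (w' : UnitaryGroup.PlacesOver L v) (i j : Fin n), ValuativeRel.valuation (w'.1.adicCompletion L)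
        (algebraMap L (w'.1.adicCompletion L) (algebraMap (Fp L) L (gramR L e dV hdV dW hdW i j))) ≤ 1)
      (_hTinv : ∀ (w' : UnitaryGroup.PlacesOver L v) (i j : Fin n), ValuativeRel.valuation (w'.1.adicCompletion L)
        (algebraMap L (w'.1.adicCompletion L) (algebraMap (Fp L) L ((gramR L e dV hdV dW hdW)⁻¹ i j))) ≤ 1)
      (χ : HeckeCharacter L) (_hχu : χ.IsUnitary) (_hχ : ∀ w' : UnitaryGroup.PlacesOver L v, χ.IsUnramifiedAt w'.1)
      (s : ℂ) (_hs : σ₀ ≤ s.re)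
      [MeasurableSpace (UnitaryGroup.localPi L (IsCMField.complexConj L) 2 (Matrix.diagonal dV) v)]
      [BorelSpace (UnitaryGroup.localPi L (IsCMField.complexConj L) 2 (Matrix.diagonal dV) v)]
      (ν : Measure (UnitaryGroup.localPi L (IsCMField.complexConj L) 2 (Matrix.diagonal dV) v)) [ν.IsHaarMeasure]
      (_hνK : ν (UnitaryGroup.localInt L (IsCMField.complexConj L) 2 (Matrix.diagonal dV) v :
          Set (UnitaryGroup.localPi L (IsCMField.complexConj L) 2 (Matrix.diagonal dV) v)) = 1)
      (ϖ : w.1.adicCompletion L) (_hϖ : Valued.v ϖ = WithZero.exp (-1 : ℤ))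
      (_hϖσ : galAdicCompletionMap (L := L) (IsCMField.complexConj L) _hw ϖ = ϖ)
      (T : GL (Fin 2) (w.1.adicCompletion L)) (_hTi : T ∈ glInt 2 (w.1.adicCompletion L))
      (_hTJ : UnitaryGroup.placeForm (Matrix.diagonal dV) w.1 =
        formCongr (galAdicCompletionMap (L := L) (IsCMField.complexConj L) _hw) T ((StdForm.antidiagonal 2).over (w.1.adicCompletion L)))
      (t₁ : UnitaryGroup.localPi L (IsCMField.complexConj L) 2 (Matrix.diagonal dV) v)
      (_ht₁ : (((t₁ : UnitaryGroup.LocalGLPi L 2 v) w : GL (Fin 2) (w.1.adicCompletion L)) : Matrix (Fin 2) (Fin 2) (w.1.adicCompletion L)) =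
        ((T⁻¹ : GL (Fin 2) (w.1.adicCompletion L)) : Matrix (Fin 2) (Fin 2) (w.1.adicCompletion L)) * Matrix.diagonal ![ϖ, ϖ⁻¹] *
          (T : Matrix (Fin 2) (Fin 2) (w.1.adicCompletion L))),
      Integrable (fun g => LambdaLoc L e dV hdV dW hdW v χ s (iotaLeftLocPi L e dV hdV dW hdW v g)) ν ∧
        ∫ g, ‖LambdaLoc L e dV hdV dW hdW v χ s (iotaLeftLocPi L e dV hdV dW hdW v g)‖ ∂ν ≤
          1 + C * (v.residueCard : ℝ) ^ (-(2 * s.re)) := by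
  -- ### the constant `C = 2 ∕ (1 − 2^{−2σ₀})`
  set y : ℝ := (2 : ℝ) ^ (-(2 * σ₀)) with hydef
  have hy0 : 0 ≤ y := (Real.rpow_pos_of_pos two_pos _).le
  have hy1 : y < 1 := Real.rpow_lt_one_of_one_lt_of_neg one_lt_two (by linarith)
  have h1y : 0 < 1 - y := sub_pos.2 hy1
  refine ⟨2 / (1 - y), div_nonneg zero_le_two h1y.le, ?_⟩
  intro L _ _ _ n e dV hdV hdV0 dW hdW hdW0 v w hw hv h2 hdVw hT hTinv χ hχu hχ s hs _ _ ν _ hνK ϖ hϖ hϖσ T hTi hTJ t₁ ht₁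
  classical
  haveI : Algebra.IsQuadraticExtension (Fp L) L := IsCMField.isQuadraticExtension L
  have hσ : 0 < s.re := lt_of_lt_of_le hσ₀ hs
  set Kv := UnitaryGroup.localInt L (IsCMField.complexConj L) 2 (Matrix.diagonal dV) v with hKvdef
  -- ### the place data: `q = q_v ≥ 2`, `N(w) = q²`, `‖ϖ‖ = q⁻²`
  set q : ℕ := v.residueCard with hqdef
  have hq1 : 1 < q := by
    rw [hqdef, HeightOneSpectrum.residueCard_eq_card_quotient]
    haveI : Finite (𝓞 (Fp L) ⧸ v.asIdeal) := Ideal.finiteQuotientOfFreeOfNeBot v.asIdeal v.ne_bot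
    haveI : v.asIdeal.IsPrime := v.isPrime
    haveI : IsDomain (𝓞 (Fp L) ⧸ v.asIdeal) := Ideal.Quotient.isDomain v.asIdeal
    exact Finite.one_lt_card
  have hqpos : 0 < q := by omega
  have hq1r : (1 : ℝ) < q := by exact_mod_cast hq1
  have hq2r : (2 : ℝ) ≤ q := by exact_mod_cast (show 2 ≤ q from hq1)
  have hQ : w.1.residueCard = q ^ 2 := by
    have h1 : Nat.card 𝓀[w.1.adicCompletion L] = w.1.residueCard := by
      rw [HeightOneSpectrum.residueCard_eq_card_quotient]
      exact IsDedekindDomain.HeightOneSpectrum.natCard_residueField_adicCompletion L w.1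
    rw [← h1, natCard_residueField_eq_sq_inert L v w hw hv]
  have hnu : ‖(HeckeCharacter.uniformizer L w.1 : w.1.adicCompletion L)‖ = ((w.1.residueCard : ℝ))⁻¹ := HeckeCharacter.norm_uniformizer w.1
  have hnormϖ : ‖ϖ‖ = ((q ^ 2 : ℕ) : ℝ)⁻¹ := by
    rw [← hQ, ← hnu, NumberField.FinitePlace.norm_def, NumberField.FinitePlace.norm_def, hϖ,
      HeckeCharacter.valued_uniformizer (K := L) (v := w.1)]
  -- ### the group data: `K_v` compact open, the Cartan family `m ↦ t₁ᵐ` (★ p857060)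
  have hKopen : IsOpen (Kv : Set (UnitaryGroup.localPi L (IsCMField.complexConj L) 2 (Matrix.diagonal dV) v)) :=
    UnitaryGroup.isOpen_localInt L (IsCMField.complexConj L) 2 (Matrix.diagonal dV) v
  have hKcpt : IsCompact (Kv : Set (UnitaryGroup.localPi L (IsCMField.complexConj L) 2 (Matrix.diagonal dV) v)) :=
    UnitaryGroup.isCompact_localInt L (IsCMField.complexConj L) 2 (Matrix.diagonal dV) v
  set t : ℕ → UnitaryGroup.localPi L (IsCMField.complexConj L) 2 (Matrix.diagonal dV) v := fun m => t₁ ^ m with htdef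
  let f : UnitaryGroup.localPi L (IsCMField.complexConj L) 2 (Matrix.diagonal dV) v →* GL (Fin 2) (w.1.adicCompletion L) :=
    { toFun := fun g => (g : UnitaryGroup.LocalGLPi L 2 v) w
      map_one' := rfl
      map_mul' := fun _ _ => rfl }
  have ht' : ∀ m : ℕ, Units.val ((t m : UnitaryGroup.LocalGLPi L 2 v) w) =
      ((T⁻¹ : GL (Fin 2) (w.1.adicCompletion L)) : Matrix (Fin 2) (Fin 2) (w.1.adicCompletion L)) *
        Matrix.diagonal ![ϖ ^ m, (ϖ ^ m)⁻¹] * (T : Matrix (Fin 2) (Fin 2) (w.1.adicCompletion L)) := fun m =>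
    coe_pow_of_coe_eq_conj_diagonal f T t₁ ht₁ m
  have hCartan : IsCartanFamily Kv t := isCartanFamily_localInt_inert L dV v w hw hv hϖ hϖσ T hTi hTJ t ht'
  have hm : ∀ g : UnitaryGroup.localPi L (IsCMField.complexConj L) 2 (Matrix.diagonal dV) v,
      MeasurableSet (DoubleCoset.doubleCoset g (Kv : Set _) Kv) := fun g => measurableSet_doubleCoset hKopen g
  have hfin : ∀ m : ℕ, ν (DoubleCoset.doubleCoset (t m) (Kv : Set _) Kv) < ⊤ := fun m =>
    ((hKcpt.mul isCompact_singleton).mul hKcpt).measure_lt_top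
  -- ### the shell volumes (★ H3a): `ν(K) = 1`, `ν(K t₁^{k+1} K) = (q+1) q (q q)^k`
  have hvol : ∀ m : ℕ, (ν (DoubleCoset.doubleCoset (t m) (Kv : Set _) Kv)).toReal =
      ((if m = 0 then 1 else (q + 1) * q * (q * q) ^ (m - 1) : ℕ) : ℝ) := by
    intro m
    obtain ⟨hfinm, hcard⟩ := ncard_orbit_pow_inert L dV v w hw hv hϖ hϖσ T hTi hTJ t₁ ht₁ m
    rw [htdef]
    rw [measure_doubleCoset_eq_ncard_mul _ ν hKopen (t₁ ^ m) hfinm, hνK, mul_one, ENNReal.toReal_natCast, hcard]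
  have hvol0 : (ν (DoubleCoset.doubleCoset (t 0) (Kv : Set _) Kv)).toReal = 1 := by
    rw [hvol 0, if_pos rfl, Nat.cast_one]
  have hvolS : ∀ k : ℕ, (ν (DoubleCoset.doubleCoset (t (k + 1)) (Kv : Set _) Kv)).toReal = ((q : ℝ) + 1) * q * ((q : ℝ) * q) ^ k := by
    intro k
    rw [hvol (k + 1), if_neg (Nat.succ_ne_zero k), Nat.add_sub_cancel]
    push_cast
    ring
  have hvol_le : ∀ m : ℕ, (ν (DoubleCoset.doubleCoset (t m) (Kv : Set _) Kv)).toReal ≤ ((q : ℝ) + 1) * q * ((q : ℝ) * q) ^ m := by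
    intro m
    rcases m with _ | k
    · rw [hvol0, pow_zero, mul_one]; nlinarith
    · rw [hvolS k, pow_succ]
      have hqq1 : (1 : ℝ) ≤ (q : ℝ) * q := by nlinarith
      have hpos : (0 : ℝ) ≤ ((q : ℝ) + 1) * q * ((q : ℝ) * q) ^ k := by positivity
      nlinarith
  -- ### the kernel `Λ_{s,v} ∘ ι_v(·,1)`: bi-invariance (★ D7d) and values on the family (★ #27i)
  set Λ' : UnitaryGroup.localPi L (IsCMField.complexConj L) 2 (Matrix.diagonal dV) v → ℂ :=
    fun g => LambdaLoc L e dV hdV dW hdW v χ s (iotaLeftLocPi L e dV hdV dW hdW v g) with hΛ'def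
  have hΛ : ∀ x ∈ Kv, ∀ y ∈ Kv, ∀ g : UnitaryGroup.localPi L (IsCMField.complexConj L) 2 (Matrix.diagonal dV) v, Λ' (x * g * y) = Λ' g :=
    fun x hx y hy g => by
    simp only [hΛ'def]
    rw [lambdaLoc_iotaLeft_mul_localInt L e dV hdV dW hdW v χ s hχ (x * g) hy, lambdaLoc_iotaLeft_localInt_mul L e dV hdV dW hdW v χ s hχ g hx]
  have hn2 : n = 2 := by have h := Fintype.card_congr e; simpa using h.symm
  set θ : ℂ := χ.valueAtUniformizer w.1 with hθdef
  set Y : ℂ := θ * (q : ℂ) ^ (-(2 * s + 2)) with hYdef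
  have hqq : ((q : ℂ) ^ 2) ^ (-(s + 1)) = (q : ℂ) ^ (-(2 * s + 2)) := by
    rw [← Complex.cpow_nat_mul' (x := (q : ℂ)) (n := 2) (by rw [Complex.natCast_arg, mul_zero]; exact neg_lt_zero.2 Real.pi_pos)
      (by rw [Complex.natCast_arg, mul_zero]; exact Real.pi_pos.le)]
    congr 1; push_cast; ring
  have hΛt : ∀ m : ℕ, Λ' (t m) = Y ^ m := by
    intro m
    have h := lambdaLoc_iotaLeftLocPi_cartan_inert L e dV hdV dW hdW v χ s hχ w hw hϖ hϖσ T hTi hTJ m (t m) (ht' m)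
    simp only [hΛ'def]
    rw [h, hn2, show s + ((2 : ℕ) : ℂ) / 2 = s + 1 by push_cast; ring, hnormϖ, ofReal_inv_pow_cpow (pow_pos hqpos 2), Nat.cast_pow, hqq,
      hYdef, mul_pow]
  -- `r = q^{−(2σ+2)}`, `x = q q r = q^{−2σ} ≤ y = 2^{−2σ₀} < 1`
  set r : ℝ := (q : ℝ) ^ (-(2 * s.re + 2)) with hrdef
  have hr0 : 0 ≤ r := Real.rpow_nonneg (Nat.cast_nonneg q) _
  have hYnorm : ‖Y‖ = r := by
    rw [hYdef, norm_mul, show ‖χ.valueAtUniformizer w.1‖ = 1 from hχu _, one_mul, Complex.norm_natCast_cpow_of_pos hqpos]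
    simp [hrdef]
  have hΛnorm : ∀ m : ℕ, ‖Λ' (t m)‖ = r ^ m := fun m => by rw [hΛt m, norm_pow, hYnorm]
  set x : ℝ := (q : ℝ) ^ (-(2 * s.re)) with hxdef
  have hqr : (q : ℝ) * q * r = x := by
    rw [hrdef, hxdef, show -(2 * s.re + 2) = -(2 * s.re) + (-2 : ℝ) by ring, Real.rpow_add (by positivity),
      show ((-2 : ℝ)) = ((-2 : ℤ) : ℝ) by norm_num, Real.rpow_intCast, _root_.zpow_neg, zpow_ofNat]
    field_simp
  have hx0 : 0 ≤ x := Real.rpow_nonneg (Nat.cast_nonneg q) _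
  have hxy : x ≤ y := by
    calc x = (q : ℝ) ^ (-(2 * s.re)) := rfl
      _ ≤ (q : ℝ) ^ (-(2 * σ₀)) := Real.rpow_le_rpow_of_exponent_le hq1r.le (by linarith)
      _ ≤ (2 : ℝ) ^ (-(2 * σ₀)) := Real.rpow_le_rpow_of_nonpos two_pos hq2r (by linarith)
  have hx1 : x < 1 := lt_of_le_of_lt hxy hy1
  -- ### per shell: integrability and `∫_{K t_m K} ‖Λ‖ = ν(K t_m K) · r^m`
  have hintS : ∀ m : ℕ, IntegrableOn Λ' (DoubleCoset.doubleCoset (t m) (Kv : Set _) Kv) ν := fun m =>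
    IntegrableOn.congr_fun (f := fun _ => Λ' (t m)) (integrableOn_const (hfin m).ne)
      (fun x hx => by simp only [apply_eq_of_mem_doubleCoset hΛ hx]) (hm _)
  have hcoset : ∀ m : ℕ, ∫ x in DoubleCoset.doubleCoset (t m) (Kv : Set _) Kv, ‖Λ' x‖ ∂ν =
      (ν (DoubleCoset.doubleCoset (t m) (Kv : Set _) Kv)).toReal * r ^ m := by
    intro m
    have heq : Set.EqOn (fun x => ‖Λ' x‖) (fun _ => r ^ m) (DoubleCoset.doubleCoset (t m) (Kv : Set _) Kv) := fun x hx => by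
      simp only [apply_eq_of_mem_doubleCoset hΛ hx, hΛnorm m]
    rw [setIntegral_congr_fun (hm _) heq, setIntegral_const, smul_eq_mul, Measure.real]
  -- crude bound for summability: `∫_{K t_m K} ‖Λ‖ ≤ (q+1) q x^m`
  have hbnd : ∀ m : ℕ, ∫ x in DoubleCoset.doubleCoset (t m) (Kv : Set _) Kv, ‖Λ' x‖ ∂ν ≤ ((q : ℝ) + 1) * q * x ^ m := by
    intro m
    rw [hcoset m, ← hqr, mul_pow]
    calc (ν (DoubleCoset.doubleCoset (t m) (Kv : Set _) Kv)).toReal * r ^ m ≤ ((q : ℝ) + 1) * q * ((q : ℝ) * q) ^ m * r ^ m :=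
          mul_le_mul_of_nonneg_right (hvol_le m) (pow_nonneg hr0 _)
      _ = _ := by ring
  have hsum_bound : Summable fun m : ℕ => ∫ x in DoubleCoset.doubleCoset (t m) (Kv : Set _) Kv, ‖Λ' x‖ ∂ν :=
    Summable.of_nonneg_of_le (fun m => integral_nonneg fun x => norm_nonneg _) hbnd
      ((summable_geometric_of_lt_one hx0 hx1).mul_left (((q : ℝ) + 1) * q))
  have hint : Integrable Λ' ν := by
    have key := integrableOn_iUnion_of_summable_integral_norm (μ := ν) hintS hsum_bound
    rw [iUnion_doubleCoset_eq_univ hCartan, integrableOn_univ] at key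
    exact key
  refine ⟨hint, ?_⟩
  -- ### the integral of the norm as the Cartan series `Σ_m ν(K t_m K) r^m`
  have hseries : HasSum (fun m : ℕ => ∫ x in DoubleCoset.doubleCoset (t m) (Kv : Set _) Kv, ‖Λ' x‖ ∂ν) (∫ x, ‖Λ' x‖ ∂ν) := by
    have h := hasSum_integral_iUnion (μ := ν) (f := fun x => ‖Λ' x‖) (fun m => hm (t m)) (pairwise_disjoint_doubleCoset hCartan)
      hint.norm.integrableOn
    rwa [iUnion_doubleCoset_eq_univ hCartan, Measure.restrict_univ] at h
  set F : ℕ → ℝ := fun m => ∫ x in DoubleCoset.doubleCoset (t m) (Kv : Set _) Kv, ‖Λ' x‖ ∂ν with hFdef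
  have hF0 : F 0 = 1 := by
    simp only [hFdef]
    rw [hcoset 0, hvol0, pow_zero, mul_one]
  -- the shells `m = k + 1`: `F (k+1) = (q+1) q (q q)^k r^{k+1} ≤ 2 x^{k+1} ≤ 2 x y^k`
  have hFS : ∀ k : ℕ, F (k + 1) ≤ 2 * x * y ^ k := by
    intro k
    simp only [hFdef]
    rw [hcoset (k + 1), hvolS k]
    calc ((q : ℝ) + 1) * q * ((q : ℝ) * q) ^ k * r ^ (k + 1) ≤ 2 * x ^ (k + 1) := shell_term_le hq1r.le hr0 hqr k
      _ = 2 * x * x ^ k := by ring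
      _ ≤ 2 * x * y ^ k := mul_le_mul_of_nonneg_left (pow_le_pow_left₀ hx0 hxy k) (by positivity)
  have hGsum : Summable fun k : ℕ => 2 * x * y ^ k := (summable_geometric_of_lt_one hy0 hy1).mul_left (2 * x)
  have hGtsum : ∑' k : ℕ, 2 * x * y ^ k = 2 / (1 - y) * x := by
    rw [tsum_mul_left, tsum_geometric_of_lt_one hy0 hy1]
    field_simp
  have hFsum' : Summable fun k : ℕ => F (k + 1) := (summable_nat_add_iff 1).2 hseries.summable
  rw [← hseries.tsum_eq, hseries.summable.tsum_eq_zero_add]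
  have hrest : ∑' k : ℕ, F (k + 1) ≤ 2 / (1 - y) * x := by
    rw [← hGtsum]
    exact hFsum'.tsum_le_tsum hFS hGsum
  show F 0 + ∑' k : ℕ, F (k + 1) ≤ 1 + 2 / (1 - y) * ((v.residueCard : ℕ) : ℝ) ^ (-(2 * s.re))
  rw [hF0]
  exact add_le_add le_rfl hrest

end Summit.HodgeConjecture.HodgeConjecture.Cruxes.HLiu418.K2LiuDoublingZetaGL1LambdaInert

end
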